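import Summits.CriticalPhenomena.Ising3DConformalLimit.Theorems.MoebiusLimitExists.Negative.ScaleRedundant
import Summits.CriticalPhenomena.Ising3DConformalLimit.Theorems.MoebiusLimitExists.Negative.FreeTranslations

/-!
# `MoebiusLimit` (item stmt-CriticalPhenomena-1344), REDUCED: limit + non-degeneracy + `O(3)` + inversion

Structural knowledge about the crux `…Theses.EnergyNotSigmaSquared.MoebiusLimit`
(= `PerfectScreening.MoebiusLimitExists`), standing crux disprover (D-0016); THEOREM-ONLY.
Combining `Negative/ScaleRedundant.lean` (dilations and `0 < Δ` automatic, `Δ` forced) with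
`Negative/FreeTranslations.lean` (translations automatic for any pointwise limit):

* `moebiusLimit_iff_rotation_inversion` — the crux is EQUIVALENT to
  `∃ ρ Δ S, ρ > 0 on (0,1] ∧ HasPointwiseScalingLimit (criticalCorr 3) ρ S ∧ IsNondegenerateTwoPoint S
   ∧ IsRotationInvariant S ∧ IsInversionCovariant Δ S`;
* `critIsing3DConformalLimit_iff_rotation_inversion` — the sub-problem statement is the same plus
  `HasNontrivialU4 S`;
* `critIsing3DEuclideanLimit_iff_rotation` — crit-ising.S03 is
  `∃ ρ S, ρ > 0 ∧ limit ∧ nondeg ∧ IsRotationInvariant S`.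
So of the Möbius generators only the `O(3)`-upgrade of the lattice symmetries and the unit
inversion carry content; every route must prove exactly: existence of a non-degenerate limit,
full rotation invariance, inversion covariance (and (iii)).
-/

noncomputable section

namespace Summit.CriticalPhenomena.Ising3DConformalLimit.MoebiusLimitExistsNegative

open Literature.Probability.LatticeModels Filter Set
open scoped Topology


/-- **The crux, reduced**: `MoebiusLimit` is equivalent to the existence of a non-degenerate
pointwise limit of the critical correlators which is `O(3)` invariant and inversion covariant for
some `Δ` — translations, dilations and `0 < Δ` are automatic. [folklore] -/
theorem moebiusLimit_iff_rotation_inversion :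
    Summit.CriticalPhenomena.Ising3DConformalLimit.Theses.EnergyNotSigmaSquared.MoebiusLimit ↔
      ∃ (ρ : ℝ → ℝ) (Δ : ℝ) (S : CorrFamily 3), (∀ δ ∈ Set.Ioc (0:ℝ) 1, 0 < ρ δ) ∧
        HasPointwiseScalingLimit (criticalCorr 3) ρ S ∧ IsNondegenerateTwoPoint S ∧
          IsRotationInvariant S ∧ IsInversionCovariant Δ S := by
  constructor
  · rintro ⟨ρ, Δ, S, h1, -, h3, h4, h5⟩
    exact ⟨ρ, Δ, S, h1, h3, h4, h5.1.2, h5.2.2⟩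
  · rintro ⟨ρ, Δ, S, hρ, hlim, hnd, hrot, hinv⟩
    exact moebiusLimit_iff_without_scale.2 ⟨ρ, Δ, _, hρ, normalised_hasLimit hlim,
      normalised_nondeg hnd, ⟨isTranslationInvariant_normalised_of_limit hlim, normalised_rotation hrot⟩,
      normalised_inversion hinv⟩

/-- **The conjunct, reduced**: existence of a non-degenerate pointwise limit + `O(3)` + inversion
covariance + `U₄ ≢ 0`. [folklore] -/
theorem critIsing3DConformalLimit_iff_rotation_inversion :
    CritIsing3DConformalLimit ↔
      ∃ (ρ : ℝ → ℝ) (Δ : ℝ) (S : CorrFamily 3), (∀ δ ∈ Set.Ioc (0:ℝ) 1, 0 < ρ δ) ∧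
        HasPointwiseScalingLimit (criticalCorr 3) ρ S ∧ IsNondegenerateTwoPoint S ∧
          IsRotationInvariant S ∧ IsInversionCovariant Δ S ∧ HasNontrivialU4 S := by
  constructor
  · rintro ⟨ρ, Δ, S, h1, -, h3, h4, h5, h6⟩
    exact ⟨ρ, Δ, S, h1, h3, h4, h5.1.2, h5.2.2, h6⟩
  · rintro ⟨ρ, Δ, S, hρ, hlim, hnd, hrot, hinv, hU⟩
    exact critIsing3DConformalLimit_iff_without_scale.2 ⟨ρ, Δ, _, hρ, normalised_hasLimit hlim,
      normalised_nondeg hnd, ⟨isTranslationInvariant_normalised_of_limit hlim, normalised_rotation hrot⟩,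
      normalised_inversion hinv, hasNontrivialU4_normalised_iff.2 hU⟩

/-- **The Euclidean-limit conjecture (crit-ising.S03), reduced**: existence of a non-degenerate
pointwise limit of the critical correlators on `ℤ³` that is `O(3)` invariant — nothing else.
[folklore] -/
theorem critIsing3DEuclideanLimit_iff_rotation :
    CritIsing3DEuclideanLimit ↔
      ∃ (ρ : ℝ → ℝ) (S : CorrFamily 3), (∀ δ ∈ Set.Ioc (0:ℝ) 1, 0 < ρ δ) ∧
        HasPointwiseScalingLimit (criticalCorr 3) ρ S ∧ IsNondegenerateTwoPoint S ∧
          IsRotationInvariant S := by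
  constructor
  · rintro ⟨ρ, Δ, S, h1, -, h3, h4, h5, -⟩
    exact ⟨ρ, S, h1, h3, h4, h5.2⟩
  · rintro ⟨ρ, S, hρ, hlim, hnd, hrot⟩
    exact critIsing3DEuclideanLimit_iff_without_scale.2 ⟨ρ, _, hρ, normalised_hasLimit hlim,
      normalised_nondeg hnd, ⟨isTranslationInvariant_normalised_of_limit hlim, normalised_rotation hrot⟩⟩

end Summit.CriticalPhenomena.Ising3DConformalLimit.MoebiusLimitExistsNegative

end
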